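import Mathlib.GroupTheory.PresentedGroup
import Mathlib.Algebra.Group.Subgroup.Basic
import Mathlib.Algebra.Group.End
import Mathlib.Tactic.Group
import Literature.Topology.FourManifolds.GroupTrisections
import HarnessLib

/-!
# Stub `stub_partialConjPowCongruent` of line `power-twist-absorption` for crux
`CongruenceShadows.ShadowsStandard` (item stmt-SmoothPoincare4-14593)

**Power-twist absorption, separating-twist piece (abstract form).**  Let
`S_g = ⟨a₁,b₁,…,a_g,b_g ∣ ∏[aᵢ,bᵢ]⟩` be the surface group of the tree
(`Literature.Topology.FourManifolds.SurfaceGroup`), `M ◁ S_g` a normal subgroup, `w ∈ S_g` with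
`w ^ e ∈ M`, and `T` an automorphism of `S_g` acting on each standard generator `x` either as
conjugation by `w` (when `P x`) or trivially, and fixing `w`.  Then `T ^ e ≡ id (mod M)`, i.e.
`(T ^ e) s * s⁻¹ ∈ M` for every `s`:

1. by induction on `n`, `(T ^ n) x = w ^ n x (w ^ n)⁻¹` if `P x` and `= x` otherwise
   (`T w = w ⇒ T (w ^ n) = w ^ n`);
2. hence `(T ^ e) x · x⁻¹ = w ^ e · (x (w ^ e)⁻¹ x⁻¹) ∈ M` (normality) or `= 1`;
3. for normal `M` the set `{s | (T ^ e) s · s⁻¹ ∈ M}` is a subgroup containing every generator,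
   hence everything (`PresentedGroup.generated_by`).

Pure group theory over Mathlib; no definitions, no named facts.
-/

-- the prescribed namespace `Summit.<P>.<Sub>.…` duplicates `SmoothPoincare4` (P = Sub)
set_option linter.dupNamespace false

noncomputable section

open Literature.Topology.FourManifolds Subgroup

namespace Summit.SmoothPoincare4.SmoothPoincare4.Theorems.ShadowsStandard.PowerTwistAbsorption

/-- **Generator criterion.**  For a normal subgroup `M ◁ S_g` and an automorphism `φ` of `S_g`,
congruence `φ x · x⁻¹ ∈ M` on the `2g` standard generators implies `φ s · s⁻¹ ∈ M` for all `s`: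
the set of such `s` is a subgroup (`φ(st)(st)⁻¹ = (φ s s⁻¹)(s (φ t t⁻¹) s⁻¹)`). [folklore] -/
private theorem congruent_of_generators {g : ℕ} {M : Subgroup (SurfaceGroup g)} (hM : M.Normal)
    {φ : SurfaceGroup g ≃* SurfaceGroup g}
    (h : ∀ x : surfaceGen g, φ (PresentedGroup.of x) * (PresentedGroup.of x)⁻¹ ∈ M) :
    ∀ s : SurfaceGroup g, φ s * s⁻¹ ∈ M := by
  -- adapted from the lead's skeleton `congruentMod_of_generators` (genus `3 + 3m`)
  let H : Subgroup (SurfaceGroup g) :=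
    { carrier := {s | φ s * s⁻¹ ∈ M}
      mul_mem' := by
        intro s t hs ht
        have e : φ (s * t) * (s * t)⁻¹ = (φ s * s⁻¹) * (s * (φ t * t⁻¹) * s⁻¹) := by
          rw [map_mul]; group
        change φ (s * t) * (s * t)⁻¹ ∈ M
        rw [e]
        exact M.mul_mem hs (hM.conj_mem _ ht s)
      one_mem' := by
        change φ 1 * (1 : SurfaceGroup g)⁻¹ ∈ M
        simp [M.one_mem]
      inv_mem' := by
        intro s hs
        change φ s⁻¹ * s⁻¹⁻¹ ∈ M
        have h1 : s * (φ s)⁻¹ ∈ M := by simpa using M.inv_mem hs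
        have h2 : s⁻¹ * (s * (φ s)⁻¹) * s⁻¹⁻¹ ∈ M := hM.conj_mem _ h1 s⁻¹
        simpa [map_inv, mul_assoc] using h2 }
  intro s
  exact PresentedGroup.generated_by _ H h s

/-- **Powers of a partial conjugation on generators.**  If `T` conjugates the generator `x` by `w`
when `P x`, fixes it otherwise, and fixes `w`, then `(T ^ n) x = w ^ n x (w ^ n)⁻¹` when `P x` and
`(T ^ n) x = x` otherwise. [folklore] -/
private theorem pow_apply_of {g : ℕ} (P : surfaceGen g → Prop) [DecidablePred P]
    (w : SurfaceGroup g) (T : SurfaceGroup g ≃* SurfaceGroup g)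
    (hT : ∀ x : surfaceGen g, T (PresentedGroup.of x) =
      if P x then w * PresentedGroup.of x * w⁻¹ else PresentedGroup.of x)
    (hw : T w = w) (n : ℕ) (x : surfaceGen g) :
    (T ^ n) (PresentedGroup.of x) =
      if P x then w ^ n * PresentedGroup.of x * (w ^ n)⁻¹ else PresentedGroup.of x := by
  induction n with
  | zero => simp
  | succ n ih =>
    rw [pow_succ', MulAut.mul_apply, ih]
    by_cases hx : P x
    · rw [if_pos hx, if_pos hx, map_mul, map_mul, map_inv, map_pow, hw, hT, if_pos hx]
      group
    · rw [if_neg hx, if_neg hx, hT, if_neg hx]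

/-- **Power-twist absorption, separating-twist piece** (stub `stub_partialConjPowCongruent` of the
line `power-twist-absorption`): if an automorphism `T` of the surface group `S_g` acts on each
standard generator either as conjugation by a fixed `w` (when `P x`) or trivially, fixes `w`, and
`w ^ e` lies in the normal subgroup `M`, then `T ^ e ≡ id (mod M)`:
`(T ^ e) s · s⁻¹ ∈ M` for every `s ∈ S_g`. [folklore] -/
theorem stub_partialConjPowCongruent :
    ∀ (g e : ℕ) (P : surfaceGen g → Prop) [DecidablePred P] (w : SurfaceGroup g)
      (M : Subgroup (SurfaceGroup g)), M.Normal →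
      ∀ T : SurfaceGroup g ≃* SurfaceGroup g,
      (∀ x : surfaceGen g, T (PresentedGroup.of x) =
          if P x then w * PresentedGroup.of x * w⁻¹ else PresentedGroup.of x) →
      T w = w → w ^ e ∈ M →
      ∀ s : SurfaceGroup g, (T ^ e) s * s⁻¹ ∈ M := by
  intro g e P _ w M hM T hT hw he
  refine congruent_of_generators hM ?_
  intro x
  rw [pow_apply_of P w T hT hw e x]
  by_cases hx : P x
  · rw [if_pos hx]
    have h1 : PresentedGroup.of x * (w ^ e)⁻¹ * (PresentedGroup.of x)⁻¹ ∈ M :=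
      hM.conj_mem _ (M.inv_mem he) _
    have h2 : w ^ e * (PresentedGroup.of x * (w ^ e)⁻¹ * (PresentedGroup.of x)⁻¹) ∈ M :=
      M.mul_mem he h1
    simpa [mul_assoc] using h2
  · rw [if_neg hx, mul_inv_cancel]
    exact M.one_mem

end Summit.SmoothPoincare4.SmoothPoincare4.Theorems.ShadowsStandard.PowerTwistAbsorption
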